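import Summits.Ventures.Crystal3D.Theorems.StickyWulffConstantCoaxialWallLawPayerPairCount
import HarnessLib

/-!
# The pooled word-end multiplicity row: LOCAL ⇒ GLOBAL (the deficiency-proportional discharge)

HONEST FRAMING. Venture `Summits/Ventures/Crystal3D` (cell `crystal3d-full`), helper `--supports` the crux
`CoaxialWallLaw` (stmt-Ventures-19481, `route-Ventures-StickyWulffConstant`), REGISTERED line `WallLedgerF` (planner
cf-p1), open stub `stub_coaxialTwoSlabAdhesion`.  Rung credit only; F-C1 not moved.  STEP-0 of DECISION (xxxiii)
(memo HOME/wall-19481-p2/F-CALIB-g6.md §3, row text HOME/wall-19481-p2/g6-EndPairRow.lean): the census certifies a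
LOCAL row — at every payer `z`, the end balls `b` within distance `1` load it by `Σ_b T_b / Dpool(b) ≤ s_F`, where
`T_b` is the number of end pairs ending at `b` and `Dpool(b)` the total deficiency of the payers within distance `1`
of `b` — and the STEP-2 glue needs the GLOBAL consequence replacing `card_endPairs_le_payers_closed` (`78·#PAY`).
This file is that consequence, as pure finite-sum bookkeeping (no geometry beyond `dist`):

* **`card_endPairs_le_of_localRow`** — `X` a finite configuration, `T` a finite set of (end ball, predecessor) pairs
  with end balls in `X`, `PAYW ⊆ {z ∈ X : deg z ≤ 11}` a payer window containing every payer within distance `1` of an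
  end ball, and every end ball having a payer within distance `1` (the exported two-payer clause gives one at distance
  `0` or `1`).  If the local row holds at every `z ∈ PAYW` with constant `s_F`, then
  `#T ≤ s_F · Σ_{z ∈ PAYW} (12 − deg z)`.
  Proof: `#T = Σ_b T_b = Σ_b Σ_{z ∈ N(b)} T_b·(12 − deg z)/Dpool(b) = Σ_z (12 − deg z)·Σ_{b ∈ B̄(z,1)} T_b/Dpool(b)`.

WHAT THIS IS NOT: not the row (a census fact), not the glue into the cells; F-C1 not moved.
-/

noncomputable section

namespace Summit.Ventures.Crystal3D.Theorems

open Summit.Ventures.Crystal3D Finset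
open scoped InnerProductSpace

open scoped Classical in
/-- **Local row ⇒ global end-pair bound (deficiency-proportional discharge).**  See the module docstring.  Here
`deg z = #{q ∈ X : dist z q = 1}`, `T_b = #{bq ∈ T : bq.1 = b}`, `Dpool b = Σ_{z ∈ X, dist b z ≤ 1, deg z ≤ 11} (12 − deg z)`. -/
theorem card_endPairs_le_of_localRow {X : Finset (EuclideanSpace ℝ (Fin 3))}
    (T : Finset (EuclideanSpace ℝ (Fin 3) × EuclideanSpace ℝ (Fin 3)))
    (PAYW : Finset (EuclideanSpace ℝ (Fin 3))) {sF : ℝ}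
    (hT : ∀ bq ∈ T, bq.1 ∈ X)
    (hPAYW : ∀ z ∈ PAYW, z ∈ X ∧ (X.filter fun q => dist z q = 1).card ≤ 11)
    (hclosed : ∀ bq ∈ T, ∀ z ∈ X, dist bq.1 z ≤ 1 → (X.filter fun q => dist z q = 1).card ≤ 11 → z ∈ PAYW)
    (hpay : ∀ bq ∈ T, ∃ z ∈ X, dist bq.1 z ≤ 1 ∧ (X.filter fun q => dist z q = 1).card ≤ 11)
    (hrow : ∀ z ∈ PAYW,
      ∑ b ∈ X.filter (fun b => dist z b ≤ 1 ∧ 0 < (T.filter fun bq => bq.1 = b).card),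
        ((T.filter fun bq => bq.1 = b).card : ℝ) /
          (∑ z' ∈ X.filter (fun z' => dist b z' ≤ 1 ∧ (X.filter fun q => dist z' q = 1).card ≤ 11),
            ((12 : ℝ) - ((X.filter fun q => dist z' q = 1).card : ℝ))) ≤ sF) :
    (T.card : ℝ) ≤ sF * ∑ z ∈ PAYW, ((12 : ℝ) - ((X.filter fun q => dist z q = 1).card : ℝ)) := by
  -- abbreviations
  set deg : EuclideanSpace ℝ (Fin 3) → ℕ := fun z => (X.filter fun q => dist z q = 1).card with hdeg
  set df : EuclideanSpace ℝ (Fin 3) → ℝ := fun z => (12 : ℝ) - (deg z : ℝ) with hdf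
  set Tb : EuclideanSpace ℝ (Fin 3) → ℕ := fun b => (T.filter fun bq => bq.1 = b).card with hTb
  set N : EuclideanSpace ℝ (Fin 3) → Finset (EuclideanSpace ℝ (Fin 3)) :=
    fun b => X.filter (fun z' => dist b z' ≤ 1 ∧ deg z' ≤ 11) with hN
  set D : EuclideanSpace ℝ (Fin 3) → ℝ := fun b => ∑ z' ∈ N b, df z' with hD
  -- payers have deficiency `≥ 1`
  have hdf1 : ∀ z, deg z ≤ 11 → 1 ≤ df z := by
    intro z hz
    have : (deg z : ℝ) ≤ 11 := by exact_mod_cast hz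
    show (1 : ℝ) ≤ 12 - (deg z : ℝ); linarith
  have hdf0 : ∀ z, deg z ≤ 11 → 0 ≤ df z := fun z hz => le_trans zero_le_one (hdf1 z hz)
  -- an end ball has positive pooled deficiency
  have hDpos : ∀ b ∈ X, 0 < Tb b → 0 < D b := by
    intro b hb hTb0
    obtain ⟨bq, hbq⟩ := card_pos.1 hTb0
    obtain ⟨hbqT, hb1⟩ := mem_filter.1 hbq
    obtain ⟨z, hzX, hdz, hz11⟩ := hpay bq hbqT
    rw [hb1] at hdz
    have hzN : z ∈ N b := mem_filter.2 ⟨hzX, hdz, hz11⟩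
    calc (0 : ℝ) < df z := lt_of_lt_of_le one_pos (hdf1 z hz11)
      _ ≤ D b := single_le_sum (fun z' hz' => hdf0 z' (mem_filter.1 hz').2.2) hzN
  -- (1) `#T = Σ_{b ∈ X} T_b`
  have h1 : (T.card : ℝ) = ∑ b ∈ X, (Tb b : ℝ) := by
    have := card_eq_sum_card_fiberwise (f := fun bq : EuclideanSpace ℝ (Fin 3) × EuclideanSpace ℝ (Fin 3) => bq.1)
      (s := T) (t := X) (fun bq hbq => hT bq hbq)
    rw [this]; push_cast; rfl
  -- (2) distribute each `T_b` over the payers around `b`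
  have h2 : ∀ b ∈ X, (Tb b : ℝ) = ∑ z ∈ N b, (Tb b : ℝ) * df z / D b := by
    intro b hb
    by_cases h0 : Tb b = 0
    · rw [h0]; simp
    · have hpos : 0 < D b := hDpos b hb (Nat.pos_of_ne_zero h0)
      have e : ∑ z ∈ N b, (Tb b : ℝ) * df z / D b = (Tb b : ℝ) / D b * ∑ z ∈ N b, df z := by
        rw [mul_sum]; refine sum_congr rfl fun z _ => ?_; ring
      rw [e]
      show (Tb b : ℝ) = (Tb b : ℝ) / D b * D b
      rw [div_mul_cancel₀ _ hpos.ne']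
  -- (3) exchange the two sums: pairs `(b, z)` with `b ∈ X`, `z ∈ N b` ↔ `z ∈ PAY`, `b ∈ M z`
  set PAY := X.filter (fun z => deg z ≤ 11) with hPAY
  set M : EuclideanSpace ℝ (Fin 3) → Finset (EuclideanSpace ℝ (Fin 3)) :=
    fun z => X.filter (fun b => dist z b ≤ 1) with hM
  have h3 : ∑ b ∈ X, ∑ z ∈ N b, (Tb b : ℝ) * df z / D b = ∑ z ∈ PAY, ∑ b ∈ M z, (Tb b : ℝ) * df z / D b := by
    refine sum_comm' ?_
    intro b z
    constructor
    · rintro ⟨hb, hz⟩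
      obtain ⟨hzX, hdz, hz11⟩ := mem_filter.1 hz
      exact ⟨mem_filter.2 ⟨hb, by rw [dist_comm]; exact hdz⟩, mem_filter.2 ⟨hzX, hz11⟩⟩
    · rintro ⟨hb, hz⟩
      obtain ⟨hzX, hz11⟩ := mem_filter.1 hz
      obtain ⟨hbX, hdz⟩ := mem_filter.1 hb
      exact ⟨hbX, mem_filter.2 ⟨hzX, by rw [dist_comm]; exact hdz, hz11⟩⟩
  -- (4) the inner sum at a payer: `df z · Σ_b T_b / D b ≤ df z · sF`, and it vanishes off `PAYW`
  have h4 : ∀ z ∈ PAY, ∑ b ∈ M z, (Tb b : ℝ) * df z / D b ≤ (if z ∈ PAYW then df z * sF else 0) := by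
    intro z hz
    obtain ⟨hzX, hz11⟩ := mem_filter.1 hz
    -- restrict to end balls
    have hres : ∑ b ∈ M z, (Tb b : ℝ) * df z / D b =
        ∑ b ∈ X.filter (fun b => dist z b ≤ 1 ∧ 0 < Tb b), (Tb b : ℝ) * df z / D b := by
      symm
      refine sum_subset (fun b hb => ?_) (fun b hb hnb => ?_)
      · obtain ⟨hbX, hd, -⟩ := mem_filter.1 hb
        exact mem_filter.2 ⟨hbX, hd⟩
      · obtain ⟨hbX, hd⟩ := mem_filter.1 hb
        have h0 : Tb b = 0 := by
          by_contra h0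
          exact hnb (mem_filter.2 ⟨hbX, hd, Nat.pos_of_ne_zero h0⟩)
        rw [h0]; simp
    rw [hres]
    by_cases hzW : z ∈ PAYW
    · rw [if_pos hzW]
      have e : ∑ b ∈ X.filter (fun b => dist z b ≤ 1 ∧ 0 < Tb b), (Tb b : ℝ) * df z / D b =
          df z * ∑ b ∈ X.filter (fun b => dist z b ≤ 1 ∧ 0 < Tb b), (Tb b : ℝ) / D b := by
        rw [mul_sum]; refine sum_congr rfl fun b _ => ?_; ring
      rw [e]
      exact mul_le_mul_of_nonneg_left (hrow z hzW) (hdf0 z hz11)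
    · rw [if_neg hzW]
      -- no end ball within distance `1` of `z`, else `z ∈ PAYW`
      have hempty : X.filter (fun b => dist z b ≤ 1 ∧ 0 < Tb b) = ∅ := by
        refine filter_eq_empty_iff.2 fun b hbX ⟨hd, hTb0⟩ => hzW ?_
        obtain ⟨bq, hbq⟩ := card_pos.1 hTb0
        obtain ⟨hbqT, hb1⟩ := mem_filter.1 hbq
        exact hclosed bq hbqT z hzX (by rw [hb1, dist_comm]; exact hd) hz11
      rw [hempty, sum_empty]
  -- (5) assemble
  have h5 : ∑ z ∈ PAY, (if z ∈ PAYW then df z * sF else 0) = sF * ∑ z ∈ PAYW, df z := by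
    rw [← sum_filter]
    have hsub : PAY.filter (fun z => z ∈ PAYW) = PAYW := by
      ext z
      constructor
      · intro hz; exact (mem_filter.1 hz).2
      · intro hz
        obtain ⟨hzX, hz11⟩ := hPAYW z hz
        exact mem_filter.2 ⟨mem_filter.2 ⟨hzX, hz11⟩, hz⟩
    rw [hsub, mul_sum]
    exact sum_congr rfl fun z _ => by ring
  calc (T.card : ℝ) = ∑ b ∈ X, (Tb b : ℝ) := h1
    _ = ∑ b ∈ X, ∑ z ∈ N b, (Tb b : ℝ) * df z / D b := sum_congr rfl h2
    _ = ∑ z ∈ PAY, ∑ b ∈ M z, (Tb b : ℝ) * df z / D b := h3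
    _ ≤ ∑ z ∈ PAY, (if z ∈ PAYW then df z * sF else 0) := sum_le_sum h4
    _ = sF * ∑ z ∈ PAYW, df z := h5

end Summit.Ventures.Crystal3D.Theorems

end
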